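import Summits.CriticalPhenomena.PercolationContinuityZ3.Theorems.PercNearOneGluingNoHeavyQuantTreeBuiltRows
import Summits.CriticalPhenomena.PercolationContinuityZ3.Theorems.PercNearOneGluingNoHeavyQuantTreeDECOfSDEC
import HarnessLib

/-!
# QUANT lane R8, T-DEC: THE GATE INTERACTION IS ONE EXTRA PARAMETER OF THE CONVOLUTION STEP — the PINNED convolution
# `pconv L π μ = (L − π·δ₀) ∗ μ + π·δ₀`, the conjecture `LawDec.PinnedConvClosed`, and the kernel implications
# `PinnedConvClosed ⟹ SDECConvClosed ⟹ TreeBuiltDEC ⟹ Quant.TreeDEC ∧ Quant.FarTreeRow`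

builds on p205010 (kernel theorem, internal audit signed; external expert review pending)

Statement + support file (`--supports stmt-CriticalPhenomena-4575`), QUANT lane LEAD seat prim-quant-lead (gen 24), rung R8 of
`run/shared/lean/prim/quant/LADDER.md` (memo `run/shared/lean/prim/quant/prim-quant-lead-g24/LEAD-NOTES-G24.md` N54).  One definition
(`LawDec.pconv`), one `@[conjecture]` (`LawDec.PinnedConvClosed`), theorems with standard axioms, no sorries.

THE OBSERVATION.  The law-level architecture of record closes `Quant.FarTreeRow` from ONE conjecture, census-2 g53's `LawDec.SDECConvClosed`
("gate-stable DEC is closed under convolution"), which quantifies over every gate `q ∈ (0,1]` on both factors and was judged 'not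
fixed-dimensional'.  But a gate COMMUTES with convolution up to pinning: for probability laws `ν`, `μ`,
`gate (ν ∗ μ) q = (q·ν) ∗ μ + (1−q)·δ₀ = pconv (gate ν q) (1−q) μ`, where `pconv L π μ := (L − π·δ₀) ∗ μ + π·δ₀` convolves `μ` with all of `L`
EXCEPT a pinned mass `π ≤ L 0` left at `0` (`gate_lconv_eq_pconv`).  Hence gate-stability of DEC under convolution follows from ONE closure
statement at ONE gate: **`PinnedConvClosed`** — if `L` (probability law on `{0..M₁}`) is DEC at every layer at floor `y` (target its mean),
`0 ≤ π ≤ L 0`, `π ≤ 1 − y`, and `μ` (probability law on `{0..M₂}`) is DEC at every layer at a floor `x_μ < 1` with `y ≤ (1 − π)·x_μ`, then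
`pconv L π μ` is DEC at every layer at floor `y` (target its mean `mean L + (1−π)·mean μ`).  At `π = 0` this is convolution closure at the
mean (census-1 g20 / census-2 g56's `ConvClosedT` programme); the gate interaction is the single extra coordinate `π` (a "pinned zero").
EVIDENCE (lead g24, exact rationals, `prim-quant-lead-g24/explore/c2/`): 0 failures on 20 479 pairs (extreme rays of the lifted all-layer
hypothesis cone with the mean constraint, `M₁ ≤ 4`, floors 1/3…3/4, second factors = blobs / two-blob systems / 3-atom DEC laws at floor
exactly `y/(1−π)`) + 800 random pairs (boundary-pushed `L`; forest laws as `μ`; and the tree-shaped instances `L = gate ν q`); the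
component-wise reduction with full sure credit FAILS for `π > 0` (`pcomp.py`: a sure relay under the pinned gate earns `(1−π)·k`, not
`(1−π)·2k`), so the statement is genuinely two-sided, like `ConvClosedT`'s light-straddler residue.

* `LawDec.pconv M₁ M₂ L π μ` — the pinned convolution (indicator bookkeeping as in `LawDec.lconv`).
* `LawDec.lconv_smul_left`, `LawDec.gate_lconv_eq_pconv` — `gate (lconv μ₁ μ₂) q = pconv (gate μ₁ q) (1 − q) μ₂`.
* `LawDec.PinnedConvClosed` (`@[conjecture]`).
* **`LawDec.sdecConvClosed_of_pinnedConvClosed : PinnedConvClosed → SDECConvClosed`**, hence (existing kernel chain, census-2 g53 / typer g22 /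
  lead g20) **`treeBuiltDEC_of_pinnedConvClosed`**, **`treeDEC_of_pinnedConvClosed : PinnedConvClosed → Quant.TreeDEC`**,
  **`farTreeRow_of_pinnedConvClosed : PinnedConvClosed → Quant.FarTreeRow`**.

HONEST STATUS: `PinnedConvClosed`, `SDECConvClosed`, `TreeBuiltDEC`, `Quant.TreeDEC`, `Quant.FarTreeRow` remain OPEN; this file only moves
the gate interaction inside the convolution step.  Nothing here changes the lane's rate / class statements.
[this work]; architecture prim-quant-census-2 g49/g53, lead g20/g24 (this lane).  The gluing rows served
[cite: KozmaNitzan2024, Conjecture 3 (p. 15)]; product measure [cite: Grimmett1999, §1.3 p. 10].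
-/

noncomputable section

namespace Summit.CriticalPhenomena.PercolationContinuityZ3.Theorems

namespace Quant

open Finset

namespace LawDec

/-! ### The pinned convolution -/

/-- **Pinned convolution**: convolve `μ` (a law on `{0..M₂}`) with the law `L` on `{0..M₁}` MINUS a pinned mass `π` at atom `0`, and put the
pinned mass back at `0`: `pconv L π μ = lconv (L − π·δ₀) μ + π·δ₀`.  For `L = gate ν q`, `π = 1 − q` this is `gate (lconv ν μ) q`
(`gate_lconv_eq_pconv`). [this work] -/
def pconv (M₁ M₂ : ℕ) (L : ℕ → ℝ) (π : ℝ) (μ : ℕ → ℝ) : ℕ → ℝ :=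
  fun h => lconv M₁ M₂ (fun k => L k - if k = 0 then π else 0) μ h + if h = 0 then π else 0

/-- `lconv` is homogeneous in the first factor. [this work] -/
theorem lconv_smul_left (M₁ M₂ : ℕ) (c : ℝ) (μ₁ μ₂ : ℕ → ℝ) (h : ℕ) :
    lconv M₁ M₂ (fun k => c * μ₁ k) μ₂ h = c * lconv M₁ M₂ μ₁ μ₂ h := by
  simp only [lconv, Finset.mul_sum]
  refine Finset.sum_congr rfl fun i _ => Finset.sum_congr rfl fun k _ => ?_
  split_ifs <;> ring

/-- **A gate commutes with convolution up to pinning**: `gate (lconv μ₁ μ₂) q = pconv (gate μ₁ q) (1 − q) μ₂`. [this work] -/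
theorem gate_lconv_eq_pconv (M₁ M₂ : ℕ) (μ₁ μ₂ : ℕ → ℝ) (q : ℝ) :
    gate (lconv M₁ M₂ μ₁ μ₂) q = pconv M₁ M₂ (gate μ₁ q) (1 - q) μ₂ := by
  funext h
  have e : (fun k => gate μ₁ q k - if k = 0 then (1 - q) else 0) = fun k => q * μ₁ k := by
    funext k
    simp only [gate]
    split_ifs <;> ring
  show q * lconv M₁ M₂ μ₁ μ₂ h + (if h = 0 then 1 - q else 0) =
    lconv M₁ M₂ (fun k => gate μ₁ q k - if k = 0 then (1 - q) else 0) μ₂ h + (if h = 0 then 1 - q else 0)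
  rw [e, lconv_smul_left]

/-! ### The conjecture -/

/-- **CONJECTURE (pinned convolution closure; lead g24, LEAD-NOTES-G24 N54).**  For a floor `0 < y < 1`, a probability law `L` on `{0..M₁}`
that is DEC at every layer at floor `y` (`Quant.LawDec.DECAt`, target = its mean), a pinned mass `0 ≤ π ≤ L 0` with `π ≤ 1 − y`, and a
probability law `μ` on `{0..M₂}` that is DEC at every layer at a floor `x_μ < 1` with `y ≤ (1 − π)·x_μ`, the pinned convolution
`pconv L π μ` is DEC at every layer at floor `y`.  `π = 0`: convolution closure at the mean.  The tree reading: `L = gate ν q` is the law of a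
tree with root gate `q` (hub-closed mass `1 − q` pinned at `0`), `μ` the law of an independent forest whose relays are at least `x_μ`-likely,
`y` the least marginal of the union.  EVIDENCE: 0 / 20 479 exact extreme-ray pairs + 0 / 800 random and tree-shaped pairs (file docstring).
[this work] [status: open] -/
@[conjecture] def PinnedConvClosed : Prop :=
  ∀ (y : ℝ) (M₁ M₂ : ℕ) (L μ : ℕ → ℝ) (π xμ : ℝ),
    0 < y → y < 1 →
    (∀ h, 0 ≤ L h) → (∀ h, M₁ < h → L h = 0) → (∑ h ∈ Finset.range (M₁ + 1), L h = 1) →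
    (∀ h, 0 ≤ μ h) → (∀ h, M₂ < h → μ h = 0) → (∑ h ∈ Finset.range (M₂ + 1), μ h = 1) →
    0 ≤ π → π ≤ L 0 → π ≤ 1 - y →
    xμ < 1 → y ≤ (1 - π) * xμ →
    (∀ j' : ℕ, DECAt y j' M₁ L) → (∀ j' : ℕ, DECAt xμ j' M₂ μ) →
    ∀ j' : ℕ, DECAt y j' (M₁ + M₂) (pconv M₁ M₂ L π μ)

/-! ### `PinnedConvClosed ⟹ SDECConvClosed` and the kernel chain down to `Quant.FarTreeRow` -/

/-- A gated probability law on `{0..M}` (`0 < q ≤ 1`) that is SDEC at floor `x` with `x·M ≤ mean`, `0 < x < 1`, is DEC at EVERY layer at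
floor `q·x` after gating by `q` (below the top: SDEC; at and above: Theorem A for the gated law, which is top-affordable at floor `q·x`).
[this work] -/
theorem decAt_gate_of_sdec {x : ℝ} {M : ℕ} {μ : ℕ → ℝ} (hs : SDEC x M μ) (hx0 : 0 < x) (hx1 : x < 1)
    (hμ0 : ∀ h, 0 ≤ μ h) (hμM : ∀ h, M < h → μ h = 0) (hμ1 : ∑ h ∈ Finset.range (M + 1), μ h = 1)
    (htop : x * (M : ℝ) ≤ ∑ h ∈ Finset.range (M + 1), (h : ℝ) * μ h) (q : ℝ) (hq0 : 0 < q) (hq1 : q ≤ 1) (j' : ℕ) :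
    DECAt (q * x) j' M (gate μ q) := by
  have hg0 : ∀ h, 0 ≤ gate μ q h := by
    intro h; simp only [gate]; split_ifs <;> nlinarith [hμ0 h]
  have hgM : ∀ h, M < h → gate μ q h = 0 := by
    intro h hh; simp only [gate]; rw [hμM h hh, if_neg (by omega)]; ring
  have hg1 : ∑ h ∈ Finset.range (M + 1), gate μ q h = 1 := sum_gate μ q M hμ1
  have hgtop : (q * x) * (M : ℝ) ≤ ∑ h ∈ Finset.range (M + 1), (h : ℝ) * gate μ q h := by
    rw [sum_mul_gate]; nlinarith
  exact decAt_of_sdec (sdec_gate hs q hq0 hq1) (mul_pos hq0 hx0) (by nlinarith) hg0 hgM hg1 hgtop j'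

/-- **`PinnedConvClosed ⟹ SDECConvClosed`.**  For SDEC laws `μ₁`, `μ₂` at floor `x` and a gate `q`: `gate (lconv μ₁ μ₂) q = pconv (gate μ₁ q) (1−q) μ₂`
with `gate μ₁ q` DEC at every layer at floor `q·x` (`decAt_gate_of_sdec`), pinned mass `1 − q ≤ (gate μ₁ q) 0`, `1 − q ≤ 1 − q·x`, and `μ₂` DEC at every
layer at floor `x` with `q·x = (1 − (1−q))·x`. [this work] -/
theorem sdecConvClosed_of_pinnedConvClosed (hP : PinnedConvClosed) : SDECConvClosed := by
  intro x M₁ M₂ μ₁ μ₂ hx0 hx1 n1 z1 s1 t1 n2 z2 s2 t2 d1 d2 q hq0 hq1 j' _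
  rw [gate_lconv_eq_pconv]
  have hL : ∀ j'' : ℕ, DECAt (q * x) j'' M₁ (gate μ₁ q) := decAt_gate_of_sdec d1 hx0 hx1 n1 z1 s1 t1 q hq0 hq1
  have hμ : ∀ j'' : ℕ, DECAt x j'' M₂ μ₂ := decAt_of_sdec d2 hx0 hx1 n2 z2 s2 t2
  have hg0 : ∀ h, 0 ≤ gate μ₁ q h := by
    intro h; simp only [gate]; split_ifs <;> nlinarith [n1 h]
  have hgM : ∀ h, M₁ < h → gate μ₁ q h = 0 := by
    intro h hh; simp only [gate]; rw [z1 h hh, if_neg (by omega)]; ring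
  have hg1 : ∑ h ∈ Finset.range (M₁ + 1), gate μ₁ q h = 1 := sum_gate μ₁ q M₁ s1
  have hpi : 1 - q ≤ gate μ₁ q 0 := by
    have hg : gate μ₁ q 0 = q * μ₁ 0 + (1 - q) := by simp [gate]
    rw [hg]; nlinarith [n1 0, hq0.le]
  exact hP (q * x) M₁ M₂ (gate μ₁ q) μ₂ (1 - q) x (mul_pos hq0 hx0) (by nlinarith) hg0 hgM hg1 n2 z2 s2
    (by linarith) hpi (by nlinarith) hx1 (by ring_nf; rfl) hL hμ j'

/-- **`PinnedConvClosed ⟹ TreeBuiltDEC`** (every tree-built count law is DEC at every layer). [this work] -/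
theorem treeBuiltDEC_of_pinnedConvClosed (hP : PinnedConvClosed) : TreeBuiltDEC :=
  treeBuiltDEC_of_sdecConvClosed (sdecConvClosed_of_pinnedConvClosed hP)

/-- **`PinnedConvClosed ⟹ TreeBuiltFAR`** (the far-relay row for every tree-built law). [this work] -/
theorem treeBuiltFAR_of_pinnedConvClosed (hP : PinnedConvClosed) : TreeBuiltFAR :=
  treeBuiltFAR_of_sdecConvClosed (sdecConvClosed_of_pinnedConvClosed hP)

end LawDec

/-- **`LawDec.PinnedConvClosed ⟹ Quant.TreeDEC`** (the typed finite-layer T-DEC conjecture for every rooted forest). [this work] -/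
theorem treeDEC_of_pinnedConvClosed (hP : LawDec.PinnedConvClosed) : TreeDEC :=
  treeDEC_of_sdecConvClosed (LawDec.sdecConvClosed_of_pinnedConvClosed hP)

/-- **`LawDec.PinnedConvClosed ⟹ Quant.FarTreeRow`** — the R8 tree row follows in the kernel from the pinned convolution closure alone.
CONDITIONAL result: `PinnedConvClosed` is `@[conjecture]`. [this work] -/
theorem farTreeRow_of_pinnedConvClosed (hP : LawDec.PinnedConvClosed) : FarTreeRow :=
  farTreeRow_of_treeBuiltDEC (LawDec.treeBuiltDEC_of_pinnedConvClosed hP)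

/-! ### ERRATUM AND CORRECTED STATEMENTS (lead g24, same session, 04:05Z)

`LawDec.PinnedConvClosed` above asks the second factor `μ` to be merely DEC at every layer.  THAT FORM IS FALSE: with `L = δ₀` and `π = 1 − q`
the pinned convolution is plain gating, `pconv δ₀ (1−q) μ = gate μ q`, and DEC-at-every-layer is NOT gate-closed for general laws
(census-2 g53, DEC-CLOSURE-G53 §2.3: e.g. `μ = {1: 36/73, 2: 1/73, 6: 36/73}`, `x_μ = 1/2`, `q = 5/6`; kernel refutation `not_pinnedConvClosed` in
`…QuantPinnedConvRefutation`).  The implications proved above from it stay true but are vacuous.  The evidence quoted in the file docstring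
was gathered with GATE-STABLE second factors only (blobs, two-blob systems, 3-atom DEC laws, forest laws), which is why it saw no failure.
The corrected statements ask the second factor to be gate-stable — exactly what the structural induction supplies (the second factor is
always a forest law, SDEC by induction) — and the same one-line algebra gives `SDECConvClosed`, `TreeBuiltDEC`, `Quant.TreeDEC`, `Quant.FarTreeRow`:

* `LawDec.PinnedConvGateClosed` (`@[conjecture]`): as `PinnedConvClosed` but `gate μ q′` DEC at every layer at floor `q′·x_μ` for EVERY `0 < q′ ≤ 1`.
* `LawDec.PinnedConvClosedQ` (`@[conjecture]`, the sharper working form): `μ` and the ONE gated law `gate μ q₀`, `q₀ = 1 − π / L 0`, DEC at every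
  layer — the only gate that occurs, since `pconv L π μ = L(0)·gate μ q₀ + Σ_{h ≥ 1} L(h)·shift_h μ`; polyhedral at fixed `q₀` (what the exact
  atomic reduction of census-2 g56 needs).  `pinnedConvGateClosed_of_Q : PinnedConvClosedQ → PinnedConvGateClosed`.
* `sdecConvClosed_of_pinnedConvGateClosed`, `treeBuiltDEC_of_pinnedConvGateClosed`, `treeBuiltFAR_of_pinnedConvGateClosed`,
  `Quant.treeDEC_of_pinnedConvGateClosed`, `Quant.farTreeRow_of_pinnedConvGateClosed`.
EVIDENCE for the corrected forms (lead g24, exact, `prim-quant-lead-g24/explore/c2/`): the 20 479 + 800 pairs of the docstring (all second factors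
there are gate-stable) and the ADVERSARIAL census `pconv_adv.py` of the `Q` form — second factors = bimodal-plus-dust laws (the gating
counterexample family) and random laws, each pushed to its LARGEST floor at which `μ` and `gate μ q₀` are both DEC at every layer, `L` over
pinned extreme rays and `δ₀`: 0 failures (counts in LEAD-NOTES-G24 N54).  HONEST: both corrected forms are OPEN. -/

namespace LawDec

open Finset

/-- **CONJECTURE (pinned convolution closure with a GATE-STABLE second factor; lead g24).**  For a floor `0 < y < 1`, a probability law `L` on
`{0..M₁}` that is DEC at every layer at floor `y` (target = its mean), a pinned mass `0 ≤ π ≤ L 0` with `π ≤ 1 − y`, and a probability law `μ` on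
`{0..M₂}` such that EVERY gated law `gate μ q′` (`0 < q′ ≤ 1`; `q′ = 1` is `μ`) is DEC at every layer at floor `q′·x_μ`, where `x_μ < 1` and
`y ≤ (1 − π)·x_μ`: the pinned convolution `pconv L π μ` is DEC at every layer at floor `y`.  `L = δ₀` is gating itself (true by hypothesis);
`π = 0` is convolution closure at the mean with a gate-stable second factor.  Implies `SDECConvClosed` (`sdecConvClosed_of_pinnedConvGateClosed`).
[this work] [status: open] -/
@[conjecture] def PinnedConvGateClosed : Prop :=
  ∀ (y : ℝ) (M₁ M₂ : ℕ) (L μ : ℕ → ℝ) (π xμ : ℝ),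
    0 < y → y < 1 →
    (∀ h, 0 ≤ L h) → (∀ h, M₁ < h → L h = 0) → (∑ h ∈ Finset.range (M₁ + 1), L h = 1) →
    (∀ h, 0 ≤ μ h) → (∀ h, M₂ < h → μ h = 0) → (∑ h ∈ Finset.range (M₂ + 1), μ h = 1) →
    0 ≤ π → π ≤ L 0 → π ≤ 1 - y →
    xμ < 1 → y ≤ (1 - π) * xμ →
    (∀ j' : ℕ, DECAt y j' M₁ L) →
    (∀ q' : ℝ, 0 < q' → q' ≤ 1 → ∀ j' : ℕ, DECAt (q' * xμ) j' M₂ (gate μ q')) →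
    ∀ j' : ℕ, DECAt y j' (M₁ + M₂) (pconv M₁ M₂ L π μ)

/-- **CONJECTURE (pinned convolution closure, ONE-GATE form; lead g24).**  As `PinnedConvGateClosed`, but the second factor is asked to be DEC
at every layer only for ITSELF (floor `x_μ`) and for the ONE gated law `gate μ q₀`, `q₀ = 1 − π / L 0` (floor `q₀·x_μ`) — the gate that occurs in
`pconv L π μ = L(0)·gate μ q₀ + Σ_{h≥1} L(h)·shift_h μ`.  At fixed `q₀` the hypothesis on `μ` is polyhedral.  Implies `PinnedConvGateClosed`
(`pinnedConvGateClosed_of_Q`). [this work] [status: open] -/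
@[conjecture] def PinnedConvClosedQ : Prop :=
  ∀ (y : ℝ) (M₁ M₂ : ℕ) (L μ : ℕ → ℝ) (π xμ : ℝ),
    0 < y → y < 1 →
    (∀ h, 0 ≤ L h) → (∀ h, M₁ < h → L h = 0) → (∑ h ∈ Finset.range (M₁ + 1), L h = 1) →
    (∀ h, 0 ≤ μ h) → (∀ h, M₂ < h → μ h = 0) → (∑ h ∈ Finset.range (M₂ + 1), μ h = 1) →
    0 ≤ π → π ≤ L 0 → π ≤ 1 - y →
    xμ < 1 → y ≤ (1 - π) * xμ →
    (∀ j' : ℕ, DECAt y j' M₁ L) →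
    (∀ j' : ℕ, DECAt xμ j' M₂ μ) →
    (∀ j' : ℕ, DECAt ((1 - π / L 0) * xμ) j' M₂ (gate μ (1 - π / L 0))) →
    ∀ j' : ℕ, DECAt y j' (M₁ + M₂) (pconv M₁ M₂ L π μ)

/-- **The one-gate form implies the gate-stable form** (`q₀ = 1 − π/L 0 ∈ (0, 1]` is one of the gates, or `q₀ = 0`, `π = L 0`, and `gate μ 0` is
concentrated at `0`, DEC at every layer at floor `0` by `decAt_of_floor_nonpos`). [this work] -/
theorem pinnedConvGateClosed_of_Q (hQ : PinnedConvClosedQ) : PinnedConvGateClosed := by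
  intro y M₁ M₂ L μ π xμ hy0 hy1 l0 lM l1 m0 mM m1 hπ0 hπL hπy hx1 hyx hL hS j'
  have hμ : ∀ j'' : ℕ, DECAt xμ j'' M₂ μ := by
    intro j''
    have := hS 1 one_pos le_rfl j''
    rwa [gate_one, one_mul] at this
  have hq0le : 1 - π / L 0 ≤ 1 := by
    have : 0 ≤ π / L 0 := div_nonneg hπ0 (l0 0)
    linarith
  refine hQ y M₁ M₂ L μ π xμ hy0 hy1 l0 lM l1 m0 mM m1 hπ0 hπL hπy hx1 hyx hL hμ ?_ j'
  intro j''
  rcases lt_or_ge 0 (1 - π / L 0) with hpos | hle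
  · exact hS (1 - π / L 0) hpos hq0le j''
  · have hL0 : 0 < L 0 := by
      by_contra h
      have h0 : L 0 = 0 := le_antisymm (not_lt.1 h) (l0 0)
      rw [h0, div_zero] at hle
      linarith
    have h1 : 1 ≤ π / L 0 := by linarith
    have hπeq : π = L 0 := le_antisymm hπL (by rwa [le_div_iff₀ hL0, one_mul] at h1)
    have hq : 1 - π / L 0 = 0 := by rw [hπeq, div_self hL0.ne']; ring
    rw [hq, zero_mul]
    refine decAt_of_floor_nonpos M₂ (gate μ 0) (fun h => ?_) (fun h hh => ?_) (sum_gate μ 0 M₂ m1) 0 le_rfl j''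
    · simp only [gate]; split_ifs <;> nlinarith [m0 h]
    · simp only [gate]; rw [mM h hh, if_neg (by omega)]; ring

/-- **`PinnedConvGateClosed ⟹ SDECConvClosed`.**  `gate (lconv μ₁ μ₂) q = pconv (gate μ₁ q) (1−q) μ₂` (`gate_lconv_eq_pconv`); `gate μ₁ q` is DEC at every
layer at floor `q·x` and every `gate μ₂ q′` at floor `q′·x` (`decAt_gate_of_sdec`); pinned mass `1 − q ≤ (gate μ₁ q) 0`, `1 − q ≤ 1 − q·x`,
`q·x = (1 − (1−q))·x`. [this work] -/
theorem sdecConvClosed_of_pinnedConvGateClosed (hP : PinnedConvGateClosed) : SDECConvClosed := by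
  intro x M₁ M₂ μ₁ μ₂ hx0 hx1 n1 z1 s1 t1 n2 z2 s2 t2 d1 d2 q hq0 hq1 j' _
  rw [gate_lconv_eq_pconv]
  have hL : ∀ j'' : ℕ, DECAt (q * x) j'' M₁ (gate μ₁ q) := decAt_gate_of_sdec d1 hx0 hx1 n1 z1 s1 t1 q hq0 hq1
  have hμ : ∀ q' : ℝ, 0 < q' → q' ≤ 1 → ∀ j'' : ℕ, DECAt (q' * x) j'' M₂ (gate μ₂ q') :=
    fun q' hq'0 hq'1 j'' => decAt_gate_of_sdec d2 hx0 hx1 n2 z2 s2 t2 q' hq'0 hq'1 j''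
  have hg0 : ∀ h, 0 ≤ gate μ₁ q h := by
    intro h; simp only [gate]; split_ifs <;> nlinarith [n1 h]
  have hgM : ∀ h, M₁ < h → gate μ₁ q h = 0 := by
    intro h hh; simp only [gate]; rw [z1 h hh, if_neg (by omega)]; ring
  have hg1 : ∑ h ∈ Finset.range (M₁ + 1), gate μ₁ q h = 1 := sum_gate μ₁ q M₁ s1
  have hpi : 1 - q ≤ gate μ₁ q 0 := by
    have hg : gate μ₁ q 0 = q * μ₁ 0 + (1 - q) := by simp [gate]
    rw [hg]; nlinarith [n1 0, hq0.le]
  exact hP (q * x) M₁ M₂ (gate μ₁ q) μ₂ (1 - q) x (mul_pos hq0 hx0) (by nlinarith) hg0 hgM hg1 n2 z2 s2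
    (by linarith) hpi (by nlinarith) hx1 (by ring_nf; rfl) hL hμ j'

/-- **`PinnedConvGateClosed ⟹ TreeBuiltDEC`**. [this work] -/
theorem treeBuiltDEC_of_pinnedConvGateClosed (hP : PinnedConvGateClosed) : TreeBuiltDEC :=
  treeBuiltDEC_of_sdecConvClosed (sdecConvClosed_of_pinnedConvGateClosed hP)

/-- **`PinnedConvGateClosed ⟹ TreeBuiltFAR`**. [this work] -/
theorem treeBuiltFAR_of_pinnedConvGateClosed (hP : PinnedConvGateClosed) : TreeBuiltFAR :=
  treeBuiltFAR_of_sdecConvClosed (sdecConvClosed_of_pinnedConvGateClosed hP)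

end LawDec

/-- **`LawDec.PinnedConvGateClosed ⟹ Quant.TreeDEC`**. [this work] -/
theorem treeDEC_of_pinnedConvGateClosed (hP : LawDec.PinnedConvGateClosed) : TreeDEC :=
  treeDEC_of_sdecConvClosed (LawDec.sdecConvClosed_of_pinnedConvGateClosed hP)

/-- **`LawDec.PinnedConvGateClosed ⟹ Quant.FarTreeRow`** — the R8 tree row follows in the kernel from the corrected pinned convolution closure
(equivalently from its one-gate form `PinnedConvClosedQ` via `pinnedConvGateClosed_of_Q`).  CONDITIONAL: both are `@[conjecture]`. [this work] -/
theorem farTreeRow_of_pinnedConvGateClosed (hP : LawDec.PinnedConvGateClosed) : FarTreeRow :=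
  farTreeRow_of_treeBuiltDEC (LawDec.treeBuiltDEC_of_pinnedConvGateClosed hP)

/-- **`LawDec.PinnedConvClosedQ ⟹ Quant.FarTreeRow`**. [this work] -/
theorem farTreeRow_of_pinnedConvClosedQ (hQ : LawDec.PinnedConvClosedQ) : FarTreeRow :=
  farTreeRow_of_pinnedConvGateClosed (LawDec.pinnedConvGateClosed_of_Q hQ)

end Quant

end Summit.CriticalPhenomena.PercolationContinuityZ3.Theorems

end
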